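/-
Copyright (c) 2026 the pub-hodgecm-mathlib formalisation cell (harness21).  Prover seat hodgecm-mathlib-K2E3-p12 (g8), Track B ∕ K2-LIT, h413 = `stmt-HodgeConjecture-24833`,
line `K2_E1_TraceFormulaBeta`, 5Res ROADCARD (154)∕(263): the M1 IDENTIFICATION of the self-dual Gram coefficient — at maximal level (`K_U`-invariant `χ`-sections) the section pairing
`B_z(φ, φ′) = (ν𝓕)⁻¹∫_{K_U} φ·conj I_{φ′}(z̄,·) dμ_K` of ★ `K2E1ChiPseudoEisensteinSelfDualVectorGramCMTwo` IS `s(z)·⟪φ,φ′⟫_K`, `s` = the scattering scalar of the (SD) M1 package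
(tube formula + conjugation symmetry, ★ p860718 ∕ ★ p860743) ⇒ `hSD` of ★ :184 in the SKELETON currency «`⟪ṽ_b, M z ṽ_a⟫ = s z · ⟪ṽ_b, ṽ_a⟫`», letter-free up to the package letters.
-/
import Summits.HodgeConjecture.HodgeConjecture.Theorems.K2E1ChiPseudoEisensteinSelfDualVectorGramCMTwo   -- ★ p860772 (this seat): (SD) in vector-Gram currency
import HarnessLib

/-!
# (263) — `K2E1ChiSectionPlancherelSDGramM1CMTwo`: AT MAXIMAL LEVEL `B_z(φ,φ′) = s(z)·∫_{K_U} φ·conj φ′ dμ_K`, HENCE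
# `⟨θ_{f,φ}, θ_{f′,φ′}⟩_X = C·(2π)⁻¹∫_ℝ f̃(z)·⟪φ,φ′⟫_K·( conj f̃′(−(1−z̄)) + s(z)·conj f̃′(−z̄) ) dt` (`z = σ₀ + it`, `σ₀ > 1`)

Track B ∕ K2-LIT, crux h413 = `stmt-HodgeConjecture-24833`, route of record `HCCMUnconditional`; cell `hodgecm-mathlib`, squad K2, ENGINE E1.  THEOREMS ONLY (no `def`, no `instance`,
no `notation`, no named-fact hypothesis, no `sorry`); lane `--supports stmt-HodgeConjecture-24833 --as helper` (count-neutral).  Hypothesis-first on the (SD) M1 package letters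
`hs` (tube formula of the scattering scalar, the CONCLUSION shape of ★ `K2E1ChiScatteringScalarPackageM1CMTwo.scatteringScalar_tube_of_coords` with `φ′ := φ′`) and `hconj` (`s(z̄) = conj s(z)`
on the tube, ★ `K2E1ChiScatteringConjSymmetryM1CMTwo.chi_scattering_conj_symm_m1_cm_two` — its pole set lies in `{Re ≤ 1}`).
THE MATHEMATICS ([MoeglinWaldspurger1995, II.1.7, IV.1.10]; dealer (263)).  For a RIGHT-`K_U`-INVARIANT `χ`-section `φ′` the flat section `f_w^{φ′} = φ′·H^w` is right-`K_U`-invariant, so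
the intertwining integral `I_{φ′}(w, k) = ∫_{N(𝔸)} f_w^{φ′}(w₀ v k) dν` does not depend on `k ∈ K_U` (§1); the tube formula reads `I_{φ′}(w, 1) = (ν𝓕)·φ′(1)·s(w)` (`Re w > 1`); with
`w = z̄` and `s(z̄) = conj s(z)`: `conj I_{φ′}(z̄, k) = (ν𝓕)·conj φ′(1)·s(z) = (ν𝓕)·conj φ′(k)·s(z)`, whence **`B_z(φ,φ′) = s(z)·∫_{K_U} φ·conj φ′ dμ_K`** (§2) for ANY `φ`; feeding ★ VectorGram
(§3): the two-term formula with the SCALAR Gram coefficient `s(z)·⟪φ,φ′⟫_K` — the `hSD` letter of ★ `K2E1ChiSectionPlancherelSelfDualCMTwo` :184 in K2E1-p14's skeleton currency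
«`⟪ṽ_b, M z ṽ_a⟫ = s z * ⟪ṽ_b, ṽ_a⟫`».
* §1 `integral_flatSectionU_weylLongU_maximalCompact_eq_one_cm_two`.  * §2 **`sectionPairing_eq_scatteringScalar_mul_inner_m1_cm_two`**.  * §3 **`chiPseudoEisenstein_inner_product_selfDual_scalarGram_m1_cm_two`**.
HONEST LABEL: HC_CM is proved only modulo the 7 printed citations (2 remaining named inputs: hLiu418 = `stmt-HodgeConjecture-24832`, h413 = `stmt-HodgeConjecture-24833`) until rung 0
closes; this file asserts no named fact, closes no socket; count-neutral; hypothesis-first on the (SD) M1 package letters `hs`∕`hconj` (★ payers cited).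

## References
* [MoeglinWaldspurger1995] C. Mœglin, J.-L. Waldspurger, *Spectral decomposition and Eisenstein series* (1995), II.1.7, II.2.1, IV.1.10.
* [Langlands1976] R. P. Langlands, *On the Functional Equations Satisfied by Eisenstein Series*, LNM 544 (1976), §7.
-/

set_option autoImplicit false
set_option linter.dupNamespace false  -- the mandated namespace repeats the summit's segment (`HodgeConjecture.HodgeConjecture`)

noncomputable section

open MeasureTheory Measure Set Filter Topology Complex NumberField IsDedekindDomain MulAction
open scoped Real NNReal ENNReal ComplexConjugate Pointwise
open Literature.MeasureTheory.Group Literature.NumberTheory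
open Literature.NumberTheory.Automorphic Literature.NumberTheory.Automorphic.UnitaryGroup AdelicGroupData
open Literature.NumberTheory.GaloisRepresentations (HeckeCharacter ideleGroup)
open Summit.HodgeConjecture.HodgeConjecture.Cruxes.H413.K2E1BorelEisensteinU
open Summit.HodgeConjecture.HodgeConjecture.Cruxes.H413.K2E1CharacterEisensteinU2Defs
open Summit.HodgeConjecture.HodgeConjecture.Cruxes.H413.K2E1ChiPseudoEisensteinSelfDualVectorGramCMTwo (chiPseudoEisenstein_inner_product_selfDual_vectorGram_cm_two)

namespace Summit.HodgeConjecture.HodgeConjecture.Cruxes.H413.K2E1ChiSectionPlancherelSDGramM1CMTwo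

variable (L : Type) [Field L] [NumberField L] [IsCMField L]
variable [MeasurableSpace (quasiSplit (↥(maximalRealSubfield L)) L (IsCMField.complexConj L) 2).Adelic] [BorelSpace (quasiSplit (↥(maximalRealSubfield L)) L (IsCMField.complexConj L) 2).Adelic]

/-! ## §1 For a right-`K_U`-invariant coefficient the intertwining integral is constant on `K_U` -/

omit [BorelSpace (quasiSplit (↥(maximalRealSubfield L)) L (IsCMField.complexConj L) 2).Adelic] in
/-- **`I_{φ′}(w, k) = I_{φ′}(w, 1)`** for `k ∈ K_U` when `φ′` is right-`K_U`-invariant (`f_w^{φ′}(w₀ v k) = φ′(w₀ v k)·H(w₀ v k)^w = φ′(w₀ v)·H(w₀ v)^w`, ★ `borelHeight_mul_of_mem_comap_standardMaximalCompactGL`).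
[cite: MoeglinWaldspurger1995, II.1.7] -/
theorem integral_flatSectionU_weylLongU_maximalCompact_eq_one_cm_two (ν : Measure ↥(adelicUnipotent (↥(maximalRealSubfield L)) L (IsCMField.complexConj L) 2)) {φ' : (quasiSplit (↥(maximalRealSubfield L)) L (IsCMField.complexConj L) 2).Adelic → ℂ} (hφ'K : (∀ k : (quasiSplit (↥(maximalRealSubfield L)) L (IsCMField.complexConj L) 2).Adelic, adelicVal (↥(maximalRealSubfield L)) L (IsCMField.complexConj L) 2 ((StdForm.antidiagonal 2).over L) k ∈ standardMaximalCompactGL 2 L → ∀ g : (quasiSplit (↥(maximalRealSubfield L)) L (IsCMField.complexConj L) 2).Adelic, φ' (g * k) = φ' g)) (w : ℂ) (k : ((standardMaximalCompactGL 2 L).comap (adelicVal (↥(maximalRealSubfield L)) L (IsCMField.complexConj L) 2 ((StdForm.antidiagonal 2).over L)) : Subgroup (quasiSplit (↥(maximalRealSubfield L)) L (IsCMField.complexConj L) 2).Adelic)) :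
    ∫ v : ↥(adelicUnipotent (↥(maximalRealSubfield L)) L (IsCMField.complexConj L) 2), flatSectionU φ' w (((quasiSplit (↥(maximalRealSubfield L)) L (IsCMField.complexConj L) 2).toAdelic (weylLongU ((IsCMField.complexConj L : L ≃ₐ[↥(maximalRealSubfield L)] L) : L →+* L) (rfl : (StdForm.antidiagonal 2).over L = (StdForm.antidiagonal 2).over L))) * ((v : (quasiSplit (↥(maximalRealSubfield L)) L (IsCMField.complexConj L) 2).Adelic) * (k : (quasiSplit (↥(maximalRealSubfield L)) L (IsCMField.complexConj L) 2).Adelic))) ∂ν = ∫ v : ↥(adelicUnipotent (↥(maximalRealSubfield L)) L (IsCMField.complexConj L) 2), flatSectionU φ' w (((quasiSplit (↥(maximalRealSubfield L)) L (IsCMField.complexConj L) 2).toAdelic (weylLongU ((IsCMField.complexConj L : L ≃ₐ[↥(maximalRealSubfield L)] L) : L →+* L) (rfl : (StdForm.antidiagonal 2).over L = (StdForm.antidiagonal 2).over L))) * ((v : (quasiSplit (↥(maximalRealSubfield L)) L (IsCMField.complexConj L) 2).Adelic) * 1)) ∂ν := by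
  refine integral_congr_ae (ae_of_all _ fun v => ?_)
  dsimp only
  rw [flatSectionU_apply, flatSectionU_apply, mul_one, ← mul_assoc, hφ'K _ k.2, borelHeight_mul_of_mem_comap_standardMaximalCompactGL k.2]

/-! ## §2 The M1 identification `B_z(φ,φ′) = s(z)·⟪φ,φ′⟫_K` -/

omit [BorelSpace (quasiSplit (↥(maximalRealSubfield L)) L (IsCMField.complexConj L) 2).Adelic] in
/-- **THE M1 IDENTIFICATION.**  `ν` on `N(𝔸)` with `0 < ν𝓕 < ∞`, any measure `μ_K` on `K_U`, any `φ : G(𝔸) → ℂ`, a RIGHT-`K_U`-INVARIANT `φ′` with `φ′(1) ≠ 0`, and a scalar `s` with the TUBE FORMULA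
`s(w) = (ν𝓕)⁻¹·φ′(1)⁻¹·I_{φ′}(w,1)` (`Re w > 1`; ★ `scatteringScalar_tube_of_coords`) and the CONJUGATION SYMMETRY `s(z̄) = conj s(z)` on the tube (★ `chi_scattering_conj_symm_m1_cm_two`):
for `Re z > 1`, **`(ν𝓕)⁻¹·∫_{K_U} φ(k)·conj I_{φ′}(z̄,k) dμ_K = s(z)·∫_{K_U} φ·conj φ′ dμ_K`**. [cite: MoeglinWaldspurger1995, II.1.7, IV.1.10] -/
theorem sectionPairing_eq_scatteringScalar_mul_inner_m1_cm_two (ν : Measure ↥(adelicUnipotent (↥(maximalRealSubfield L)) L (IsCMField.complexConj L) 2)) {𝓕 : Set ↥(adelicUnipotent (↥(maximalRealSubfield L)) L (IsCMField.complexConj L) 2)} (h𝓕₀ : ν 𝓕 ≠ 0) (h𝓕top : ν 𝓕 ≠ ∞) (μK : Measure ((standardMaximalCompactGL 2 L).comap (adelicVal (↥(maximalRealSubfield L)) L (IsCMField.complexConj L) 2 ((StdForm.antidiagonal 2).over L)) : Subgroup (quasiSplit (↥(maximalRealSubfield L)) L (IsCMField.complexConj L) 2).Adelic))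
    (φ : (quasiSplit (↥(maximalRealSubfield L)) L (IsCMField.complexConj L) 2).Adelic → ℂ) {φ' : (quasiSplit (↥(maximalRealSubfield L)) L (IsCMField.complexConj L) 2).Adelic → ℂ} (hφ'K : (∀ k : (quasiSplit (↥(maximalRealSubfield L)) L (IsCMField.complexConj L) 2).Adelic, adelicVal (↥(maximalRealSubfield L)) L (IsCMField.complexConj L) 2 ((StdForm.antidiagonal 2).over L) k ∈ standardMaximalCompactGL 2 L → ∀ g : (quasiSplit (↥(maximalRealSubfield L)) L (IsCMField.complexConj L) 2).Adelic, φ' (g * k) = φ' g)) (hφ'1 : φ' 1 ≠ 0)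
    {s : ℂ → ℂ} (hs : (∀ z : ℂ, 1 < z.re → s z = (((((ν 𝓕).toReal⁻¹ : ℝ))) : ℂ) * ((φ' 1)⁻¹ * ∫ v : ↥(adelicUnipotent (↥(maximalRealSubfield L)) L (IsCMField.complexConj L) 2), flatSectionU φ' z (((quasiSplit (↥(maximalRealSubfield L)) L (IsCMField.complexConj L) 2).toAdelic (weylLongU ((IsCMField.complexConj L : L ≃ₐ[↥(maximalRealSubfield L)] L) : L →+* L) (rfl : (StdForm.antidiagonal 2).over L = (StdForm.antidiagonal 2).over L))) * ((v : (quasiSplit (↥(maximalRealSubfield L)) L (IsCMField.complexConj L) 2).Adelic) * 1)) ∂ν))) (hconj : ∀ z : ℂ, 1 < z.re → s (conj z) = conj (s z)) {z : ℂ} (hz : 1 < z.re) :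
    ((((ν 𝓕).toReal⁻¹ : ℝ)) : ℂ) * ∫ k : ((standardMaximalCompactGL 2 L).comap (adelicVal (↥(maximalRealSubfield L)) L (IsCMField.complexConj L) 2 ((StdForm.antidiagonal 2).over L)) : Subgroup (quasiSplit (↥(maximalRealSubfield L)) L (IsCMField.complexConj L) 2).Adelic), φ (k : (quasiSplit (↥(maximalRealSubfield L)) L (IsCMField.complexConj L) 2).Adelic) * conj (∫ v : ↥(adelicUnipotent (↥(maximalRealSubfield L)) L (IsCMField.complexConj L) 2), flatSectionU φ' (conj z) (((quasiSplit (↥(maximalRealSubfield L)) L (IsCMField.complexConj L) 2).toAdelic (weylLongU ((IsCMField.complexConj L : L ≃ₐ[↥(maximalRealSubfield L)] L) : L →+* L) (rfl : (StdForm.antidiagonal 2).over L = (StdForm.antidiagonal 2).over L))) * ((v : (quasiSplit (↥(maximalRealSubfield L)) L (IsCMField.complexConj L) 2).Adelic) * (k : (quasiSplit (↥(maximalRealSubfield L)) L (IsCMField.complexConj L) 2).Adelic))) ∂ν) ∂μK = s z * ∫ k : ((standardMaximalCompactGL 2 L).comap (adelicVal (↥(maximalRealSubfield L)) L (IsCMField.complexConj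 L) 2 ((StdForm.antidiagonal 2).over L)) : Subgroup (quasiSplit (↥(maximalRealSubfield L)) L (IsCMField.complexConj L) 2).Adelic), φ (k : (quasiSplit (↥(maximalRealSubfield L)) L (IsCMField.complexConj L) 2).Adelic) * conj (φ' (k : (quasiSplit (↥(maximalRealSubfield L)) L (IsCMField.complexConj L) 2).Adelic)) ∂μK := by
  have hκ : (((ν 𝓕).toReal⁻¹ : ℝ) : ℂ) ≠ 0 := by
    rw [Complex.ofReal_ne_zero]
    exact inv_ne_zero (ENNReal.toReal_ne_zero.2 ⟨h𝓕₀, h𝓕top⟩)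
  have hzc : 1 < (conj z).re := by simpa using hz
  -- `I_{φ′}(z̄, k) = I_{φ′}(z̄, 1) = (ν𝓕)·φ′(1)·s(z̄)`; `conj` of it is `(ν𝓕)·conj φ′(k)·s(z)`
  have hI1 : ∫ v : ↥(adelicUnipotent (↥(maximalRealSubfield L)) L (IsCMField.complexConj L) 2), flatSectionU φ' (conj z) (((quasiSplit (↥(maximalRealSubfield L)) L (IsCMField.complexConj L) 2).toAdelic (weylLongU ((IsCMField.complexConj L : L ≃ₐ[↥(maximalRealSubfield L)] L) : L →+* L) (rfl : (StdForm.antidiagonal 2).over L = (StdForm.antidiagonal 2).over L))) * ((v : (quasiSplit (↥(maximalRealSubfield L)) L (IsCMField.complexConj L) 2).Adelic) * 1)) ∂ν = (((((ν 𝓕).toReal⁻¹ : ℝ)) : ℂ))⁻¹ * (φ' 1 * s (conj z)) := by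
    rw [hs (conj z) hzc, show ∀ I₀ : ℂ, (((((ν 𝓕).toReal⁻¹ : ℝ)) : ℂ))⁻¹ * (φ' 1 * ((((((ν 𝓕).toReal⁻¹ : ℝ)) : ℂ)) * ((φ' 1)⁻¹ * I₀))) = ((((((ν 𝓕).toReal⁻¹ : ℝ)) : ℂ))⁻¹ * (((((ν 𝓕).toReal⁻¹ : ℝ)) : ℂ))) * (φ' 1 * (φ' 1)⁻¹) * I₀ from fun I₀ => by ring,
      inv_mul_cancel₀ hκ, mul_inv_cancel₀ hφ'1, one_mul, one_mul]
  have hφ'k : ∀ k : ((standardMaximalCompactGL 2 L).comap (adelicVal (↥(maximalRealSubfield L)) L (IsCMField.complexConj L) 2 ((StdForm.antidiagonal 2).over L)) : Subgroup (quasiSplit (↥(maximalRealSubfield L)) L (IsCMField.complexConj L) 2).Adelic), φ' (k : (quasiSplit (↥(maximalRealSubfield L)) L (IsCMField.complexConj L) 2).Adelic) = φ' 1 := fun k => by rw [← one_mul (k : (quasiSplit (↥(maximalRealSubfield L)) L (IsCMField.complexConj L) 2).Adelic), hφ'K _ k.2 1]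
  have hck : ∀ k : ((standardMaximalCompactGL 2 L).comap (adelicVal (↥(maximalRealSubfield L)) L (IsCMField.complexConj L) 2 ((StdForm.antidiagonal 2).over L)) : Subgroup (quasiSplit (↥(maximalRealSubfield L)) L (IsCMField.complexConj L) 2).Adelic), conj (∫ v : ↥(adelicUnipotent (↥(maximalRealSubfield L)) L (IsCMField.complexConj L) 2), flatSectionU φ' (conj z) (((quasiSplit (↥(maximalRealSubfield L)) L (IsCMField.complexConj L) 2).toAdelic (weylLongU ((IsCMField.complexConj L : L ≃ₐ[↥(maximalRealSubfield L)] L) : L →+* L) (rfl : (StdForm.antidiagonal 2).over L = (StdForm.antidiagonal 2).over L))) * ((v : (quasiSplit (↥(maximalRealSubfield L)) L (IsCMField.complexConj L) 2).Adelic) * (k : (quasiSplit (↥(maximalRealSubfield L)) L (IsCMField.complexConj L) 2).Adelic))) ∂ν) = (((((ν 𝓕).toReal⁻¹ : ℝ)) : ℂ))⁻¹ * (conj (φ' (k : (quasiSplit (↥(maximalRealSubfield L)) L (IsCMField.complexConj L) 2).Adelic)) * s z) := fun k => by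
    rw [integral_flatSectionU_weylLongU_maximalCompact_eq_one_cm_two L ν hφ'K (conj z) k, hI1, map_mul, map_mul, map_inv₀, Complex.conj_ofReal, hconj z hz, Complex.conj_conj, hφ'k k]
  simp_rw [hck]
  rw [← integral_const_mul, ← integral_const_mul]
  refine integral_congr_ae (ae_of_all _ fun k => ?_)
  dsimp only
  rw [show (((((ν 𝓕).toReal⁻¹ : ℝ)) : ℂ)) * (φ (k : (quasiSplit (↥(maximalRealSubfield L)) L (IsCMField.complexConj L) 2).Adelic) * ((((((ν 𝓕).toReal⁻¹ : ℝ)) : ℂ))⁻¹ * (conj (φ' (k : (quasiSplit (↥(maximalRealSubfield L)) L (IsCMField.complexConj L) 2).Adelic)) * s z))) = ((((((ν 𝓕).toReal⁻¹ : ℝ)) : ℂ)) * (((((ν 𝓕).toReal⁻¹ : ℝ)) : ℂ))⁻¹) * (s z * (φ (k : (quasiSplit (↥(maximalRealSubfield L)) L (IsCMField.complexConj L) 2).Adelic) * conj (φ' (k : (quasiSplit (↥(maximalRealSubfield L)) L (IsCMField.complexConj L) 2).Adelic)))) by ring,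
    mul_inv_cancel₀ hκ, one_mul]

variable [MeasurableSpace (AdeleRing (𝓞 L) L)ˣ] [BorelSpace (AdeleRing (𝓞 L) L)ˣ]

/-! ## §3 (SD) at M1 with the SCALAR Gram coefficient `s(z)·⟪φ,φ′⟫_K` -/

/-- **(SD) AT MAXIMAL LEVEL — `hSD` IN SKELETON CURRENCY.**  Data as in ★ W-b; one `C > 0` such that for every UNITARY SELF-DUAL `χ`, continuous bounded `χ`-sections `φ, φ′` with `φ′`
RIGHT-`K_U`-INVARIANT and `φ′(1) ≠ 0`, a scalar `s` with the tube formula for `φ′` and `s(z̄) = conj s(z)` on the tube, all `f, f′ ∈ C²_c((0,∞))` and `σ₀ > 1` (`z = σ₀ + it`):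
**`∫_X θ_{f,φ}·conj θ_{f′,φ′} dμ = C·(2π)⁻¹∫_ℝ f̃(−z)·( ⟪φ,φ′⟫_K·conj f̃′(−(1−z̄)) + (s(z)·⟪φ,φ′⟫_K)·conj f̃′(−z̄) ) dt`**, `⟪φ,φ′⟫_K = ∫_{K_U} φ·conj φ′ dμ_K` — ★ VectorGram ∘ §2 under the `t`-integral:
the `hSD` bytes of ★ `K2E1ChiSectionPlancherelSelfDualCMTwo` :184 with `⟪ṽ_b, M z ṽ_a⟫ = s z * ⟪ṽ_b, ṽ_a⟫`. [cite: MoeglinWaldspurger1995, II.2.1, IV.1.10] -/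
theorem chiPseudoEisenstein_inner_product_selfDual_scalarGram_m1_cm_two
    (μ : Measure (quasiSplit (↥(maximalRealSubfield L)) L (IsCMField.complexConj L) 2).automorphicQuotient) [(quasiSplit (↥(maximalRealSubfield L)) L (IsCMField.complexConj L) 2).IsAutomorphicMeasure μ]
    (νG : Measure (quasiSplit (↥(maximalRealSubfield L)) L (IsCMField.complexConj L) 2).Adelic) [νG.IsHaarMeasure] [νG.IsInvInvariant]
    (μK : Measure ((standardMaximalCompactGL 2 L).comap (adelicVal (↥(maximalRealSubfield L)) L (IsCMField.complexConj L) 2 ((StdForm.antidiagonal 2).over L)) : Subgroup (quasiSplit (↥(maximalRealSubfield L)) L (IsCMField.complexConj L) 2).Adelic)) [μK.IsHaarMeasure]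
    (νI : Measure (AdeleRing (𝓞 L) L)ˣ) [νI.IsHaarMeasure]
    {𝓕I : Set (AdeleRing (𝓞 L) L)ˣ} (h𝓕I : IsIdeleClassDomain L 𝓕I)
    (ν : Measure ↥(adelicUnipotent (↥(maximalRealSubfield L)) L (IsCMField.complexConj L) 2)) [ν.IsHaarMeasure] {𝓕 : Set ↥(adelicUnipotent (↥(maximalRealSubfield L)) L (IsCMField.complexConj L) 2)}
    (h𝓕N : IsFundamentalDomain ↥(rationalUnipotent (↥(maximalRealSubfield L)) L (IsCMField.complexConj L) 2) 𝓕 ν) (h𝓕c : IsCompact (closure 𝓕)) (h𝓕₀ : ν 𝓕 ≠ 0) :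
    ∃ C : ℝ, 0 < C ∧
      ∀ {χ : HeckeCharacter L} {φ φ' : (quasiSplit (↥(maximalRealSubfield L)) L (IsCMField.complexConj L) 2).Adelic → ℂ}, χ.IsUnitary → reflectChar (IsCMField.complexConj L) χ = χ →
        IsChiSection χ φ → Continuous φ → ∀ {Cφ : ℝ}, (∀ x, ‖φ x‖ ≤ Cφ) →
        IsChiSection χ φ' → Continuous φ' → ∀ {Cφ' : ℝ}, (∀ x, ‖φ' x‖ ≤ Cφ') →
        (∀ k : (quasiSplit (↥(maximalRealSubfield L)) L (IsCMField.complexConj L) 2).Adelic, adelicVal (↥(maximalRealSubfield L)) L (IsCMField.complexConj L) 2 ((StdForm.antidiagonal 2).over L) k ∈ standardMaximalCompactGL 2 L → ∀ g : (quasiSplit (↥(maximalRealSubfield L)) L (IsCMField.complexConj L) 2).Adelic, φ' (g * k) = φ' g) → φ' 1 ≠ 0 →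
      ∀ {s : ℂ → ℂ}, (∀ z : ℂ, 1 < z.re → s z = (((((ν 𝓕).toReal⁻¹ : ℝ))) : ℂ) * ((φ' 1)⁻¹ * ∫ v : ↥(adelicUnipotent (↥(maximalRealSubfield L)) L (IsCMField.complexConj L) 2), flatSectionU φ' z (((quasiSplit (↥(maximalRealSubfield L)) L (IsCMField.complexConj L) 2).toAdelic (weylLongU ((IsCMField.complexConj L : L ≃ₐ[↥(maximalRealSubfield L)] L) : L →+* L) (rfl : (StdForm.antidiagonal 2).over L = (StdForm.antidiagonal 2).over L))) * ((v : (quasiSplit (↥(maximalRealSubfield L)) L (IsCMField.complexConj L) 2).Adelic) * 1)) ∂ν)) → (∀ z : ℂ, 1 < z.re → s (conj z) = conj (s z)) →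
      ∀ {f f' : ℝ → ℂ}, ContDiff ℝ 2 f → HasCompactSupport f → tsupport f ⊆ Ioi 0 → ContDiff ℝ 2 f' → HasCompactSupport f' → tsupport f' ⊆ Ioi 0 →
      ∀ {σ₀ : ℝ}, 1 < σ₀ →
        Integrable (fun x : (quasiSplit (↥(maximalRealSubfield L)) L (IsCMField.complexConj L) 2).automorphicQuotient =>
            (quasiSplit (↥(maximalRealSubfield L)) L (IsCMField.complexConj L) 2).quotFun (eisensteinSeriesU (fun g : (quasiSplit (↥(maximalRealSubfield L)) L (IsCMField.complexConj L) 2).Adelic => f (borelHeight g : ℝ) * φ g)) x * conj ((quasiSplit (↥(maximalRealSubfield L)) L (IsCMField.complexConj L) 2).quotFun (eisensteinSeriesU (fun g : (quasiSplit (↥(maximalRealSubfield L)) L (IsCMField.complexConj L) 2).Adelic => f' (borelHeight g : ℝ) * φ' g)) x)) μ ∧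
        ∫ x, (quasiSplit (↥(maximalRealSubfield L)) L (IsCMField.complexConj L) 2).quotFun (eisensteinSeriesU (fun g : (quasiSplit (↥(maximalRealSubfield L)) L (IsCMField.complexConj L) 2).Adelic => f (borelHeight g : ℝ) * φ g)) x * conj ((quasiSplit (↥(maximalRealSubfield L)) L (IsCMField.complexConj L) 2).quotFun (eisensteinSeriesU (fun g : (quasiSplit (↥(maximalRealSubfield L)) L (IsCMField.complexConj L) 2).Adelic => f' (borelHeight g : ℝ) * φ' g)) x) ∂μ = (C : ℂ) * ((((2 * π)⁻¹ : ℝ) : ℂ) * ∫ t : ℝ, mellin f (-((σ₀ : ℂ) + t * I)) * ((∫ k : ((standardMaximalCompactGL 2 L).comap (adelicVal (↥(maximalRealSubfield L)) L (IsCMField.complexConj L) 2 ((StdForm.antidiagonal 2).over L)) : Subgroup (quasiSplit (↥(maximalRealSubfield L)) L (IsCMField.complexConj L) 2).Adelic), φ (k : (quasiSplit (↥(maximalRealSubfield L)) L (IsCMField.complexConj L) 2).Adelic) * conj (φ' (k : (quasiSplit (↥(maximalRealSubfield L)) L (IsCMField.complexConj L) 2).Adelic)) ∂μK) * conj (mellin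 f' (-(1 - conj ((σ₀ : ℂ) + t * I)))) + (s ((σ₀ : ℂ) + t * I) * (∫ k : ((standardMaximalCompactGL 2 L).comap (adelicVal (↥(maximalRealSubfield L)) L (IsCMField.complexConj L) 2 ((StdForm.antidiagonal 2).over L)) : Subgroup (quasiSplit (↥(maximalRealSubfield L)) L (IsCMField.complexConj L) 2).Adelic), φ (k : (quasiSplit (↥(maximalRealSubfield L)) L (IsCMField.complexConj L) 2).Adelic) * conj (φ' (k : (quasiSplit (↥(maximalRealSubfield L)) L (IsCMField.complexConj L) 2).Adelic)) ∂μK)) * conj (mellin f' (-conj ((σ₀ : ℂ) + t * I))))) := by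
  have h𝓕top : ν 𝓕 ≠ ∞ := ((measure_mono subset_closure).trans_lt h𝓕c.measure_lt_top).ne
  obtain ⟨C, hC, hH⟩ := chiPseudoEisenstein_inner_product_selfDual_vectorGram_cm_two L μ νG μK νI h𝓕I ν h𝓕N h𝓕c h𝓕₀
  refine ⟨C, hC, ?_⟩
  intro χ φ φ' hχu hsd hφ hφc Cφ hφC hφ' hφ'c Cφ' hφ'C hφ'K hφ'1 s hs hconj f f' hf hfs hf0 hf' hf's hf'0 σ₀ hσ₀
  obtain ⟨hInt, hEq⟩ := hH hχu hsd hφ hφc hφC hφ' hφ'c hφ'C hf hfs hf0 hf' hf's hf'0 hσ₀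
  refine ⟨hInt, ?_⟩
  rw [hEq]
  congr 2
  refine integral_congr_ae (ae_of_all _ fun t => ?_)
  dsimp only
  rw [sectionPairing_eq_scatteringScalar_mul_inner_m1_cm_two L ν h𝓕₀ h𝓕top μK φ hφ'K hφ'1 hs hconj (z := ((σ₀ : ℂ) + t * I)) (by simpa using hσ₀)]

end Summit.HodgeConjecture.HodgeConjecture.Cruxes.H413.K2E1ChiSectionPlancherelSDGramM1CMTwo

end
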